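import Literature.Geometry.Riemannian.ThreeShrinkerFlatModelData
import Literature.Geometry.Riemannian.ThreeShrinkerEinsteinCase
import Literature.Geometry.Riemannian.CompactSolitonScalarCurvaturePos
import Literature.Geometry.Riemannian.ShrinkerScalarCurvatureNonneg
import Literature.Geometry.Lorentzian.PositiveMassRigidity
import HarnessLib

/-!
# Three-dimensional shrinkers whose scalar curvature vanishes somewhere

A step of the noncompact half of the classification of complete three-dimensional gradient
shrinking Ricci solitons (`threeShrinkerClassification_modelData`; Munteanu–Wang 2016, Thm. 1.2,
via Perelman / Ni–Wallach / Cao–Chen–Zhu): by B.-L. Chen's theorem `R ≥ 0` on every complete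
shrinker (the named fact `shrinkerScalarCurvature_nonneg`), and **if `R` vanishes at one point then
the soliton is the Gaussian soliton** — here for members of the binder of the fact, in any
(compact or not) connected `N`:

* `ThreeShrinker.scalarCurvature_eq_zero_of_exists` — `R ≥ 0` and `R(x₀) = 0` give `R ≡ 0`
  (E. Hopf's minimum principle `scalarCurvature_eventuallyEq_zero_of_soliton` makes the zero set
  open; it is closed; `N` is connected);
* `ThreeShrinker.ricci_eq_zero_of_scalarCurvature_eq_zero` — then `|Ric|² ≡ 0` by Hamilton's
  identity `ΔR = ⟨∇R,∇φ⟩ + R − 2|Ric|²` (`dalembertian_scalarCurvature_of_soliton`), so `Ric ≡ 0`;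
* `ThreeShrinker.modelData_of_scalarCurvature_nonneg_of_exists_zero` — in dimension three
  `Ric ≡ 0` is flat (`isFlat_of_isRicciFlat_of_finrank_eq_three`), and the flat case is the
  Gaussian soliton (`ThreeShrinker.modelData_of_isFlat`): the conclusion of the fact holds;
* `ThreeShrinker.scalarCurvature_pos_or_modelData` — the dichotomy `R > 0` everywhere, or the
  conclusion of the fact; `…_of_shrinkerScalarCurvature_nonneg` — the same from Chen's theorem as
  the named fact `shrinkerScalarCurvature_nonneg`.

Everything is proved; no definitions are introduced.

## References

* O. Munteanu, J. Wang, arXiv:1606.01861, Thm. 1.2 (p. 3), §2 (p. 6). [MunteanuWang2016]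
* B.-L. Chen, J. Differential Geom. 82 (2009), Cor. 2.5. [Chen2009]
* M. Eminenti, G. La Nave, C. Mantegazza, manuscripta math. 127 (2008), §3. [EminentiLanaveMantegazza2008]
* P. Petersen, W. Wylie, Geom. Topol. 14 (2010), Lemma 2.1 (the `f`-Laplacian of `scal`). [PetersenWylie2010]
-/

noncomputable section

set_option maxSynthPendingDepth 3

open Bundle Set Function Filter Module MeasureTheory Metric
open scoped Manifold ContDiff Topology ENNReal NNReal

namespace Literature.Geometry.Riemannian

open Lorentzian Lorentzian.PseudoRiemannianMetric

namespace ThreeShrinker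

variable (N : Type*) [TopologicalSpace N] [T2Space N]
  [ChartedSpace (EuclideanSpace ℝ (Fin 3)) N] [IsManifold (𝓡 3) ∞ N] [ConnectedSpace N]
  (h : PseudoRiemannianMetric (𝓡 3) ∞ (EuclideanSpace ℝ (Fin 3))
    (TangentSpace (𝓡 3) : N → Type _)) [h.HasLeviCivita]

omit [T2Space N] in
/-- **`R ≥ 0` and `R(x₀) = 0` give `R ≡ 0`** on a connected gradient shrinking soliton
`Ric + Hess φ = ½ h` (the zero set of `R` is open by E. Hopf's minimum principle
`scalarCurvature_eventuallyEq_zero_of_soliton` and closed by continuity).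
[cite: MunteanuWang2016, §2 (p. 6)] [cite: EminentiLanaveMantegazza2008, §3] -/
theorem scalarCurvature_eq_zero_of_exists (hh : h.IsRiemannian) {φ : N → ℝ}
    (hφ : ContMDiff (𝓡 3) 𝓘(ℝ, ℝ) ∞ φ)
    (hsol : ∀ (x : N) (X Y : TangentSpace (𝓡 3) x),
      h.ricci x X Y + h.hessian φ x X Y = (1 / 2 : ℝ) * h.val x X Y)
    (hS0 : ∀ x : N, 0 ≤ h.scalarCurvature x) {x₀ : N} (hx₀ : h.scalarCurvature x₀ = 0) (x : N) :
    h.scalarCurvature x = 0 := by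
  set Z : Set N := {x | h.scalarCurvature x = 0} with hZ
  have hZo : IsOpen Z := by
    rw [isOpen_iff_mem_nhds]
    intro y hy
    exact scalarCurvature_eventuallyEq_zero_of_soliton h hh hφ (by norm_num) hsol hS0 hy
  have hZc : IsClosed Z := isClosed_eq (contMDiff_scalarCurvature h).continuous continuous_const
  have hZu : Z = Set.univ := IsClopen.eq_univ ⟨hZc, hZo⟩ ⟨x₀, hx₀⟩
  have hx : x ∈ Z := by rw [hZu]; exact Set.mem_univ _
  exact hx

omit [T2Space N] [ConnectedSpace N] in
/-- **`R ≡ 0` forces `Ric ≡ 0`** on a gradient shrinking soliton: Hamilton's identity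
`ΔR = ⟨∇R, ∇φ⟩ + R − 2|Ric|²` (`dalembertian_scalarCurvature_of_soliton`) with `R ≡ 0` gives
`|Ric|² ≡ 0`, and `|·|²` is definite for a Riemannian metric.
[cite: PetersenWylie2010, Lemma 2.1] [cite: MunteanuWang2016, §2 (p. 6)] -/
theorem ricci_eq_zero_of_scalarCurvature_eq_zero (hh : h.IsRiemannian) {φ : N → ℝ}
    (hφ : ContMDiff (𝓡 3) 𝓘(ℝ, ℝ) ∞ φ)
    (hsol : ∀ (x : N) (X Y : TangentSpace (𝓡 3) x),
      h.ricci x X Y + h.hessian φ x X Y = (1 / 2 : ℝ) * h.val x X Y)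
    (hS : ∀ x : N, h.scalarCurvature x = 0) (x : N) : h.ricci x = 0 := by
  have hfun : h.scalarCurvature = fun _ ↦ (0 : ℝ) := funext hS
  have hid := dalembertian_scalarCurvature_of_soliton h hφ hsol x
  -- the left-hand side and the first two terms of the right-hand side vanish
  have hΔ : h.dalembertian h.scalarCurvature x = 0 := by
    unfold PseudoRiemannianMetric.dalembertian
    have h0 : h.hessian h.scalarCurvature x = 0 := by
      ext X Y
      exact hessian_apply_eq_zero_of_eq_const N h hS x X Y
    rw [h0]
    simp [PseudoRiemannianMetric.trace]
  have hd : (mvfderiv (𝓡 3) h.scalarCurvature x : TangentSpace (𝓡 3) x →ₗ[ℝ] ℝ) = 0 := by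
    rw [hfun, mvfderiv_const]
    rfl
  have hI : h.innerDual x (mvfderiv (𝓡 3) h.scalarCurvature x : TangentSpace (𝓡 3) x →ₗ[ℝ] ℝ)
      (mvfderiv (𝓡 3) φ x : TangentSpace (𝓡 3) x →ₗ[ℝ] ℝ) = 0 := by
    rw [hd]
    simp [PseudoRiemannianMetric.innerDual]
  rw [hΔ, hI, hS x] at hid
  have hN : h.normSq x (h.ricci x) = 0 := by linarith
  exact (h.normSq_eq_zero_iff x hh _).mp hN

variable [T3Space N] [MeasurableSpace N] [BorelSpace N]

/-- **A member of the binder of `threeShrinkerClassification_modelData` with `R ≥ 0` and a zero of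
`R` satisfies the conclusion of the fact** (it is the Gaussian soliton: `R ≡ 0`, `Ric ≡ 0`, hence
flat in dimension three, `isFlat_of_isRicciFlat_of_finrank_eq_three`, and the flat case is
`ThreeShrinker.modelData_of_isFlat`). [cite: MunteanuWang2016, Thm. 1.2 (p. 3), §2 (p. 6)] -/
theorem modelData_of_scalarCurvature_nonneg_of_exists_zero (hh : h.IsRiemannian) (φ : N → ℝ)
    (hcpl : ∀ (x : N) (r : ℝ≥0), IsCompact {y : N | h.edist hh x y ≤ r})
    (hφ : ContMDiff (𝓡 3) 𝓘(ℝ, ℝ) ∞ φ)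
    (hsol : ∀ (x : N) (X Y : TangentSpace (𝓡 3) x),
      h.ricci x X Y + h.hessian φ x X Y = (1 / 2 : ℝ) * h.val x X Y)
    (hnorm : ∀ x : N, h.scalarCurvature x + h.gradSq φ x = φ x)
    (hS0 : ∀ x : N, 0 ≤ h.scalarCurvature x) {x₀ : N} (hx₀ : h.scalarCurvature x₀ = 0) :
    ((∀ x : N, h.scalarCurvature x = 0) ∧
        ∫⁻ x, ENNReal.ofReal (Real.exp (-φ x))
            ∂(riemannianMeasure (h.toContMDiffRiemannianMetric hh)) =
          ENNReal.ofReal (8 * Real.pi * Real.sqrt Real.pi)) ∨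
      (CompactSpace N ∧ (∀ x : N, h.scalarCurvature x = 3 / 2) ∧ (∀ x : N, φ x = 3 / 2) ∧
        ∃ k : ℕ, 0 < k ∧
          riemannianMeasure (h.toContMDiffRiemannianMetric hh) Set.univ =
            ENNReal.ofReal (16 * Real.pi ^ 2 / k)) ∨
      ((∀ x : N, h.scalarCurvature x = 1) ∧
        ∫⁻ x, ENNReal.ofReal (Real.exp (-φ x))
            ∂(riemannianMeasure (h.toContMDiffRiemannianMetric hh)) =
          ENNReal.ofReal (16 * Real.pi * Real.sqrt Real.pi * Real.exp (-1))) ∨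
      ((∀ x : N, h.scalarCurvature x = 1) ∧
        ∫⁻ x, ENNReal.ofReal (Real.exp (-φ x))
            ∂(riemannianMeasure (h.toContMDiffRiemannianMetric hh)) =
          ENNReal.ofReal (8 * Real.pi * Real.sqrt Real.pi * Real.exp (-1))) := by
  have hS := scalarCurvature_eq_zero_of_exists N h hh hφ hsol hS0 hx₀
  have hric : h.IsRicciFlat := ricci_eq_zero_of_scalarCurvature_eq_zero N h hh hφ hsol hS
  have hflat : h.leviCivita.IsFlat :=
    h.isFlat_of_isRicciFlat_of_finrank_eq_three h.riemann_skew_holds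
      (WithTop.coe_le_coe.mpr le_top) finrank_euclideanSpace_fin hric
  exact modelData_of_isFlat N h φ hh hcpl hφ hsol hnorm hflat

/-- **Dichotomy for members of the binder with `R ≥ 0`**: either `R > 0` everywhere, or the
conclusion of `threeShrinkerClassification_modelData` holds (the Gaussian soliton).
[cite: MunteanuWang2016, Thm. 1.2 (p. 3), §2 (p. 6)] -/
theorem scalarCurvature_pos_or_modelData (hh : h.IsRiemannian) (φ : N → ℝ)
    (hcpl : ∀ (x : N) (r : ℝ≥0), IsCompact {y : N | h.edist hh x y ≤ r})
    (hφ : ContMDiff (𝓡 3) 𝓘(ℝ, ℝ) ∞ φ)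
    (hsol : ∀ (x : N) (X Y : TangentSpace (𝓡 3) x),
      h.ricci x X Y + h.hessian φ x X Y = (1 / 2 : ℝ) * h.val x X Y)
    (hnorm : ∀ x : N, h.scalarCurvature x + h.gradSq φ x = φ x)
    (hS0 : ∀ x : N, 0 ≤ h.scalarCurvature x) :
    (∀ x : N, 0 < h.scalarCurvature x) ∨
    (((∀ x : N, h.scalarCurvature x = 0) ∧
        ∫⁻ x, ENNReal.ofReal (Real.exp (-φ x))
            ∂(riemannianMeasure (h.toContMDiffRiemannianMetric hh)) =
          ENNReal.ofReal (8 * Real.pi * Real.sqrt Real.pi)) ∨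
      (CompactSpace N ∧ (∀ x : N, h.scalarCurvature x = 3 / 2) ∧ (∀ x : N, φ x = 3 / 2) ∧
        ∃ k : ℕ, 0 < k ∧
          riemannianMeasure (h.toContMDiffRiemannianMetric hh) Set.univ =
            ENNReal.ofReal (16 * Real.pi ^ 2 / k)) ∨
      ((∀ x : N, h.scalarCurvature x = 1) ∧
        ∫⁻ x, ENNReal.ofReal (Real.exp (-φ x))
            ∂(riemannianMeasure (h.toContMDiffRiemannianMetric hh)) =
          ENNReal.ofReal (16 * Real.pi * Real.sqrt Real.pi * Real.exp (-1))) ∨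
      ((∀ x : N, h.scalarCurvature x = 1) ∧
        ∫⁻ x, ENNReal.ofReal (Real.exp (-φ x))
            ∂(riemannianMeasure (h.toContMDiffRiemannianMetric hh)) =
          ENNReal.ofReal (8 * Real.pi * Real.sqrt Real.pi * Real.exp (-1)))) := by
  by_cases hpos : ∀ x : N, 0 < h.scalarCurvature x
  · exact Or.inl hpos
  · push Not at hpos
    obtain ⟨x₀, hx₀⟩ := hpos
    exact Or.inr (modelData_of_scalarCurvature_nonneg_of_exists_zero N h hh φ hcpl hφ hsol hnorm hS0
      (le_antisymm hx₀ (hS0 x₀)))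

/-- **The same dichotomy from Chen's theorem** `R ≥ 0` on complete shrinkers, taken as the named
fact `shrinkerScalarCurvature_nonneg` (Zhang 2009, Thm. 1.3 (ii) / Chen 2009, Cor. 2.5), for the
members of the binder of `threeShrinkerClassification_modelData` (second countable, `T₃`).
[cite: Chen2009, Cor. 2.5] [cite: MunteanuWang2016, Thm. 1.2 (p. 3)] -/
theorem scalarCurvature_pos_or_modelData_of_shrinkerScalarCurvature_nonneg
    (hA : shrinkerScalarCurvature_nonneg) (N : Type) [TopologicalSpace N] [T2Space N]
    [SecondCountableTopology N] [ChartedSpace (EuclideanSpace ℝ (Fin 3)) N] [IsManifold (𝓡 3) ∞ N]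
    [ConnectedSpace N] [T3Space N] [MeasurableSpace N] [BorelSpace N]
    (h : PseudoRiemannianMetric (𝓡 3) ∞ (EuclideanSpace ℝ (Fin 3))
      (TangentSpace (𝓡 3) : N → Type _)) [h.HasLeviCivita] (φ : N → ℝ) (hh : h.IsRiemannian)
    (hcpl : ∀ (x : N) (r : ℝ≥0), IsCompact {y : N | h.edist hh x y ≤ r})
    (hφ : ContMDiff (𝓡 3) 𝓘(ℝ, ℝ) ∞ φ)
    (hsol : ∀ (x : N) (X Y : TangentSpace (𝓡 3) x),
      h.ricci x X Y + h.hessian φ x X Y = (1 / 2 : ℝ) * h.val x X Y)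
    (hnorm : ∀ x : N, h.scalarCurvature x + h.gradSq φ x = φ x) :
    (∀ x : N, 0 < h.scalarCurvature x) ∨
    (((∀ x : N, h.scalarCurvature x = 0) ∧
        ∫⁻ x, ENNReal.ofReal (Real.exp (-φ x))
            ∂(riemannianMeasure (h.toContMDiffRiemannianMetric hh)) =
          ENNReal.ofReal (8 * Real.pi * Real.sqrt Real.pi)) ∨
      (CompactSpace N ∧ (∀ x : N, h.scalarCurvature x = 3 / 2) ∧ (∀ x : N, φ x = 3 / 2) ∧
        ∃ k : ℕ, 0 < k ∧
          riemannianMeasure (h.toContMDiffRiemannianMetric hh) Set.univ =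
            ENNReal.ofReal (16 * Real.pi ^ 2 / k)) ∨
      ((∀ x : N, h.scalarCurvature x = 1) ∧
        ∫⁻ x, ENNReal.ofReal (Real.exp (-φ x))
            ∂(riemannianMeasure (h.toContMDiffRiemannianMetric hh)) =
          ENNReal.ofReal (16 * Real.pi * Real.sqrt Real.pi * Real.exp (-1))) ∨
      ((∀ x : N, h.scalarCurvature x = 1) ∧
        ∫⁻ x, ENNReal.ofReal (Real.exp (-φ x))
            ∂(riemannianMeasure (h.toContMDiffRiemannianMetric hh)) =
          ENNReal.ofReal (8 * Real.pi * Real.sqrt Real.pi * Real.exp (-1)))) :=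
  scalarCurvature_pos_or_modelData N h hh φ hcpl hφ hsol hnorm
    (hA 3 N h φ hh hcpl hφ hsol hnorm)

end ThreeShrinker

end Literature.Geometry.Riemannian

end
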